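import Literature.MeasureTheory.Group.InvariantQuotientConjugacySum
import Literature.NumberTheory.Automorphic.AdelicUnitaryGroupDatum
import HarnessLib

/-!
# Orbital integrals `O_γ^m(f) = ∫_{G ⧸ C(γ)} f(y γ y⁻¹) dm(y)` — NAMED, and the local orbital
integrals of the unitary group `U(H)(L⁺_v)`
(Rogawski, *Automorphic representations of unitary groups in three variables* (1990), §4.9 p. 54
(print): `Φ(γ, f_v) = ∫_{G_γ \ G} f_v(g⁻¹ γ g) dg`; Gelbart (1975), (9.13), p. 154)

Topic `NumberTheory/Automorphic`; namespace `Literature.NumberTheory.Automorphic` (generic) and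
`….UnitaryGroup` (the unitary group). Generic definitions `orbitalIntegral`, `OrbitalMeasureFamily`, `classOrbitalIntegral`, the
unitary-group abbreviation `UnitaryGroup.localOrbitalIntegral`, and kernel lemmas; no instance, no instance
attribute, no named fact, no `sorry`.

The tree's orbital-integral CURRENCY is the orbital integrand `descConj γ M hM F : G ⧸ M → α`,
`y M ↦ F(y γ y⁻¹)` (`Literature.MeasureTheory.Group.InvariantQuotientConjugacySum`), integrated against
an invariant measure on `G ⧸ C(γ)`: the transport theorems along isomorphisms and conjugation
(`InvariantQuotientOrbitalTransport`), the product factorisations (`InvariantQuotientOrbitalProd/Pi`)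
and the geometric sides of the trace formula (`AutomorphicQuotientKernelGeometric`,
`UnitaryGroupGeometricSide`) are all stated on `∫ y, descConj γ (C(γ)) _ F y ∂μ`. This file gives that
integral a NAME, with the measure a PARAMETER (no normalisation is chosen), so that the letters of the
local transfer (`Rogawski1990/LocalTransfer`, (14.2.1): matching of `Φ(γ, f′_v)` and `Φ(ψγ, f_v)`)
can refer to it:

* `orbitalIntegral γ f m = ∫_{G ⧸ C(γ)} f(y γ y⁻¹) dm(y)` (**definition**, any group `G`, Banach-valued
  `f`, `m` a measure on `G ⧸ C_G(γ)` for a given σ-algebra); `orbitalIntegral_eq_integral_descConj`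
  (the `rfl` hook to the currency);
* `OrbitalMeasureFamily G` (measures on the orbit spaces `G ⧸ C(out c)`, `c` the conjugacy classes —
  the shape delivered by `UnitaryGroupGeometricSide`) and `classOrbitalIntegral m f c` (the orbital
  integral as a class function);
* algebra in `f`: `orbitalIntegral_zero_fun`, `_add` (under integrability of the two orbital
  integrands), `_smul`, `_neg`, `_sub`; in `m`: `_zero_measure`, `_smul_measure`;
* `orbitalIntegral_eq_zero_of_forall_notMem_tsupport` — `O_γ(f) = 0` if no conjugate of `γ` meets
  `tsupport f`;
* `orbitalIntegral_conj_eq` — **conjugation invariance of the functional** for an INVARIANT `m`: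
  `O_γ^m(f ∘ conj(x)) = O_γ^m(f)`;
* (sequel `LocalOrbitalIntegralTransport`: transport along a bicontinuous isomorphism `e : G ≃* G'`
  and between conjugate elements — the named forms of ★
  `exists_integral_descConj_eq_smul_integral_descConj_comp` / `…_of_conj_eq` of
  `InvariantQuotientOrbitalTransport`);
* `UnitaryGroup.localOrbitalIntegral L N H v γ f m` (**abbreviation**) — the same on the local unitary
  group `(cmDatum L N H).Local v = U(H)(L⁺_v)` [Rogawski1990, §4.9 p. 54], with one-line twins of the
  lemmas.

What is deliberately NOT here: convergence of orbital integrals of `C_c` functions at semisimple `γ`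
over a local field (a theorem of its own; integrability enters the lemmas as a hypothesis), any
normalisation of `m` (Tamagawa / `vol(K_v) = 1`), stable orbital integrals, transfer factors.

## References

* J. D. Rogawski, *Automorphic Representations of Unitary Groups in Three Variables*, Ann. of Math.
  Stud. 123 (1990), §4.9 p. 54 (print) [Rogawski1990].
* S. Gelbart, *Automorphic forms on adele groups*, Ann. of Math. Stud. 83 (1975), (9.13), p. 154
  [Gelbart1975].
-/

noncomputable section

open MeasureTheory Measure Set Filter Topology NumberField IsDedekindDomain
open Literature.MeasureTheory.Group
open scoped ENNReal NNReal Pointwise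

namespace Literature.NumberTheory.Automorphic

/-! ### The orbital integral as a named functional -/

section Orbital

variable {G : Type*} [Group G] {E : Type*} [NormedAddCommGroup E] [NormedSpace ℝ E]

/-- **The orbital integral** `O_γ^m(f) = ∫_{G ⧸ C_G(γ)} f(y γ y⁻¹) dm(y)` of `f : G → E` at `γ ∈ G`
against a measure `m` on the coset space of the centraliser `C_G(γ)` (for a given σ-algebra on it;
in applications the Borel one and an invariant `m`). Left cosets and `y γ y⁻¹`, the convention of the
tree's orbital integrand `descConj` (Gelbart (1975), (9.13): `∫_{G_γ \ G} φ(x⁻¹ γ x) dx` after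
`y = x⁻¹`; Rogawski (1990), §4.9: `Φ(γ, f) = ∫_{G_γ \ G} f(g⁻¹ γ g) dg`). The measure is a parameter:
no normalisation is chosen. [cite: Rogawski1990, §4.9 p. 54] -/
def orbitalIntegral (γ : G) [MeasurableSpace (G ⧸ Subgroup.centralizer ({γ} : Set G))]
    (f : G → E) (m : Measure (G ⧸ Subgroup.centralizer ({γ} : Set G))) : E :=
  ∫ y, descConj γ (Subgroup.centralizer ({γ} : Set G))
    (fun _ hg => Subgroup.mem_centralizer_singleton_iff.1 hg) f y ∂m

/-- **A family of measures on the orbit spaces `G ⧸ C(γ_c)` of representatives `γ_c = out c` of the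
conjugacy classes of `G`** — the shape in which the geometric side of the trace formula delivers its
orbital measures (`UnitaryGroupGeometricSide`: `μ_c` on `G ⧸ C(out c)`), and against which class
functions of orbital integrals are formed (`classOrbitalIntegral`). [cite: Gelbart1975, (9.13)] -/
abbrev OrbitalMeasureFamily (G : Type*) [Group G]
    [∀ γ : G, MeasurableSpace (G ⧸ Subgroup.centralizer ({γ} : Set G))] : Type _ :=
  ∀ c : ConjClasses G, Measure (G ⧸ Subgroup.centralizer ({(Quotient.out c : G)} : Set G))

/-- **The orbital integral as a class function**: `c ↦ O_{γ_c}^{m_c}(f)` at the representative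
`γ_c = out c`, for a family `m` of orbital measures (Gelbart (1975), (9.13): the terms of the geometric
side are indexed by the conjugacy classes `{γ}`). [cite: Gelbart1975, (9.13)] -/
def classOrbitalIntegral [∀ γ : G, MeasurableSpace (G ⧸ Subgroup.centralizer ({γ} : Set G))]
    (m : OrbitalMeasureFamily G) (f : G → E) (c : ConjClasses G) : E :=
  orbitalIntegral (Quotient.out c) f (m c)

/-- `classOrbitalIntegral m f c = orbitalIntegral (out c) f (m c)` (definitional). [cite: Gelbart1975, (9.13)] -/
theorem classOrbitalIntegral_eq [∀ γ : G, MeasurableSpace (G ⧸ Subgroup.centralizer ({γ} : Set G))]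
    (m : OrbitalMeasureFamily G) (f : G → E) (c : ConjClasses G) :
    classOrbitalIntegral m f c = orbitalIntegral (Quotient.out c) f (m c) := rfl

variable (γ : G) [MeasurableSpace (G ⧸ Subgroup.centralizer ({γ} : Set G))]
  (m : Measure (G ⧸ Subgroup.centralizer ({γ} : Set G)))

/-- `O_γ^m(f) = ∫ y, descConj γ C(γ) _ f y ∂m` — the hook to the tree's `descConj` currency
(transport, products, geometric sides). [cite: Rogawski1990, §4.9 p. 54] -/
theorem orbitalIntegral_eq_integral_descConj (f : G → E) :
    orbitalIntegral γ f m =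
      ∫ y, descConj γ (Subgroup.centralizer ({γ} : Set G)) (fun _ hg => Subgroup.mem_centralizer_singleton_iff.1 hg) f y ∂m := rfl

/-- `O_γ(0) = 0`. [cite: Rogawski1990, §4.9 p. 54] -/
theorem orbitalIntegral_zero_fun : orbitalIntegral γ (0 : G → E) m = 0 := by
  have h0 : descConj γ (Subgroup.centralizer ({γ} : Set G))
      (fun _ hg => Subgroup.mem_centralizer_singleton_iff.1 hg) (0 : G → E) = fun _ => (0 : E) := by
    funext y
    induction y using QuotientGroup.induction_on with
    | H x => rfl
  rw [orbitalIntegral_eq_integral_descConj, h0, integral_zero]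

/-- `O_γ` against the zero measure vanishes. [cite: Rogawski1990, §4.9 p. 54] -/
theorem orbitalIntegral_zero_measure (f : G → E) :
    orbitalIntegral γ f (0 : Measure (G ⧸ Subgroup.centralizer ({γ} : Set G))) = 0 := by
  rw [orbitalIntegral_eq_integral_descConj, integral_zero_measure]

/-- **Additivity** `O_γ(f + g) = O_γ(f) + O_γ(g)` when both orbital integrands are integrable.
[cite: Rogawski1990, §4.9 p. 54] -/
theorem orbitalIntegral_add {f g : G → E}
    (hf : Integrable (descConj γ (Subgroup.centralizer ({γ} : Set G)) (fun _ hg => Subgroup.mem_centralizer_singleton_iff.1 hg) f) m)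
    (hg : Integrable (descConj γ (Subgroup.centralizer ({γ} : Set G)) (fun _ hg => Subgroup.mem_centralizer_singleton_iff.1 hg) g) m) :
    orbitalIntegral γ (f + g) m = orbitalIntegral γ f m + orbitalIntegral γ g m := by
  simp only [orbitalIntegral_eq_integral_descConj]
  rw [← integral_add hf hg]
  refine integral_congr_ae (Eventually.of_forall fun y => ?_)
  induction y using QuotientGroup.induction_on with
  | H x => rfl

/-- **Homogeneity** `O_γ(c • f) = c • O_γ(f)` (no integrability needed). [cite: Rogawski1990, §4.9 p. 54] -/
theorem orbitalIntegral_smul {𝕜 : Type*} [NontriviallyNormedField 𝕜] [NormedSpace 𝕜 E]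
    [SMulCommClass ℝ 𝕜 E] (c : 𝕜) (f : G → E) :
    orbitalIntegral γ (c • f) m = c • orbitalIntegral γ f m := by
  simp only [orbitalIntegral_eq_integral_descConj]
  rw [← integral_smul]
  refine integral_congr_ae (Eventually.of_forall fun y => ?_)
  induction y using QuotientGroup.induction_on with
  | H x => rfl

/-- `O_γ(-f) = -O_γ(f)`. [cite: Rogawski1990, §4.9 p. 54] -/
theorem orbitalIntegral_neg (f : G → E) : orbitalIntegral γ (-f) m = -orbitalIntegral γ f m := by
  simp only [orbitalIntegral_eq_integral_descConj]
  rw [← integral_neg]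
  refine integral_congr_ae (Eventually.of_forall fun y => ?_)
  induction y using QuotientGroup.induction_on with
  | H x => rfl

/-- `O_γ(f - g) = O_γ(f) - O_γ(g)` when both orbital integrands are integrable. [cite: Rogawski1990, §4.9 p. 54] -/
theorem orbitalIntegral_sub {f g : G → E}
    (hf : Integrable (descConj γ (Subgroup.centralizer ({γ} : Set G)) (fun _ hg => Subgroup.mem_centralizer_singleton_iff.1 hg) f) m)
    (hg : Integrable (descConj γ (Subgroup.centralizer ({γ} : Set G)) (fun _ hg => Subgroup.mem_centralizer_singleton_iff.1 hg) g) m) :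
    orbitalIntegral γ (f - g) m = orbitalIntegral γ f m - orbitalIntegral γ g m := by
  simp only [orbitalIntegral_eq_integral_descConj]
  rw [← integral_sub hf hg]
  refine integral_congr_ae (Eventually.of_forall fun y => ?_)
  induction y using QuotientGroup.induction_on with
  | H x => rfl

/-- `O_γ^{c • m}(f) = c.toReal • O_γ^m(f)`: rescaling the measure rescales the orbital integral (the
only dependence on the normalisation). [cite: Rogawski1990, §4.9 p. 54] -/
theorem orbitalIntegral_smul_measure (c : ℝ≥0∞) (f : G → E) :
    orbitalIntegral γ f (c • m) = c.toReal • orbitalIntegral γ f m := by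
  simp only [orbitalIntegral_eq_integral_descConj, integral_smul_measure]

/-- **`O_γ(f) = 0` if no conjugate of `γ` meets the support of `f`**: the orbital integrand vanishes
identically. [cite: Rogawski1990, §4.9 p. 54] -/
theorem orbitalIntegral_eq_zero_of_forall_notMem_tsupport [TopologicalSpace G] {f : G → E}
    (h : ∀ g : G, g * γ * g⁻¹ ∉ tsupport f) : orbitalIntegral γ f m = 0 := by
  rw [orbitalIntegral_eq_integral_descConj]
  have hzero : descConj γ (Subgroup.centralizer ({γ} : Set G)) (fun _ hg => Subgroup.mem_centralizer_singleton_iff.1 hg) f = 0 := by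
    funext y
    induction y using QuotientGroup.induction_on with
    | H g =>
      show f (g * γ * g⁻¹) = 0
      exact image_eq_zero_of_notMem_tsupport (h g)
  rw [hzero, Pi.zero_def, integral_zero]

end Orbital

/-! ### Invariance and transport -/

section Invariance

variable {G : Type*} [Group G] [TopologicalSpace G] [IsTopologicalGroup G] (γ : G)
  [MeasurableSpace (G ⧸ Subgroup.centralizer ({γ} : Set G))]
  [BorelSpace (G ⧸ Subgroup.centralizer ({γ} : Set G))]
  (m : Measure (G ⧸ Subgroup.centralizer ({γ} : Set G)))
  [SMulInvariantMeasure G (G ⧸ Subgroup.centralizer ({γ} : Set G)) m]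

/-- **Conjugation invariance of the orbital integral** for an INVARIANT measure `m` on `G ⧸ C(γ)`:
`O_γ^m(f ∘ conj(x)) = O_γ^m(f)` for every `x ∈ G` (the orbital integrand of `f ∘ conj(x)` is the
translate by `x` of that of `f`, ★ `descConj_comp_conj_eq_descConj_smul`, and `m` is invariant).
[cite: Rogawski1990, §4.9 p. 54] -/
theorem orbitalIntegral_conj_eq (x : G) (f : G → ℂ) :
    orbitalIntegral γ (f ∘ MulAut.conj x) m = orbitalIntegral γ f m := by
  simp only [orbitalIntegral_eq_integral_descConj]
  have h1 : ∀ y, descConj γ (Subgroup.centralizer ({γ} : Set G))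
      (fun _ hg => Subgroup.mem_centralizer_singleton_iff.1 hg) (f ∘ MulAut.conj x) y =
      descConj γ (Subgroup.centralizer ({γ} : Set G))
        (fun _ hg => Subgroup.mem_centralizer_singleton_iff.1 hg) f (x • y) := fun y => by
    induction y using QuotientGroup.induction_on with
    | H g =>
      rw [MulAction.Quotient.smul_mk, descConj_mk, descConj_mk, Function.comp_apply, MulAut.conj_apply,
        smul_eq_mul]
      congr 1
      group
  simp_rw [h1]
  exact integral_smul_eq_self _

end Invariance

/-! ### The local orbital integrals of the unitary group `U(H)(L⁺_v)` -/

namespace UnitaryGroup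

variable (L : Type) [Field L] [NumberField L] [IsCMField L] (N : ℕ) (H : Matrix (Fin N) (Fin N) L)
  (v : HeightOneSpectrum (𝓞 ↥(maximalRealSubfield L)))

/-- **The local orbital integral `Φ(γ, f_v) = ∫_{G_γ \ G} f_v(g⁻¹ γ g) dg` of the unitary group
`G = U(H)(L⁺_v)`** (Rogawski (1990), §4.9 p. 54) — `orbitalIntegral` on the tree's local group
`(cmDatum L N H).Local v` (`AdelicUnitaryGroupDatum`), in the tree's convention
`∫_{G ⧸ C(γ)} f(y γ y⁻¹) dm(y)`, the measure `m` on `G ⧸ C(γ)` a PARAMETER (no normalisation chosen).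
[cite: Rogawski1990, §4.9 p. 54] -/
abbrev localOrbitalIntegral (γ : (cmDatum L N H).Local v)
    [MeasurableSpace ((cmDatum L N H).Local v ⧸ Subgroup.centralizer ({γ} : Set ((cmDatum L N H).Local v)))]
    (f : (cmDatum L N H).Local v → ℂ)
    (m : Measure ((cmDatum L N H).Local v ⧸ Subgroup.centralizer ({γ} : Set ((cmDatum L N H).Local v)))) :
    ℂ :=
  orbitalIntegral γ f m

variable (γ : (cmDatum L N H).Local v)
  [MeasurableSpace ((cmDatum L N H).Local v ⧸ Subgroup.centralizer ({γ} : Set ((cmDatum L N H).Local v)))]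
  (m : Measure ((cmDatum L N H).Local v ⧸ Subgroup.centralizer ({γ} : Set ((cmDatum L N H).Local v))))

/-- `Φ(γ, f) = ∫ y, descConj γ C(γ) _ f y ∂m` (hook to the `descConj` currency). [cite: Rogawski1990, §4.9 p. 54] -/
theorem localOrbitalIntegral_eq_integral_descConj (f : (cmDatum L N H).Local v → ℂ) :
    localOrbitalIntegral L N H v γ f m =
      ∫ y, descConj γ (Subgroup.centralizer ({γ} : Set ((cmDatum L N H).Local v)))
        (fun _ hg => Subgroup.mem_centralizer_singleton_iff.1 hg) f y ∂m := rfl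

/-- `Φ(γ, 0) = 0`. [cite: Rogawski1990, §4.9 p. 54] -/
theorem localOrbitalIntegral_zero_fun :
    localOrbitalIntegral L N H v γ (0 : (cmDatum L N H).Local v → ℂ) m = 0 :=
  orbitalIntegral_zero_fun γ m

/-- `Φ(γ, f + g) = Φ(γ, f) + Φ(γ, g)` under integrability of both orbital integrands.
[cite: Rogawski1990, §4.9 p. 54] -/
theorem localOrbitalIntegral_add {f g : (cmDatum L N H).Local v → ℂ}
    (hf : Integrable (descConj γ (Subgroup.centralizer ({γ} : Set ((cmDatum L N H).Local v)))
      (fun _ hg => Subgroup.mem_centralizer_singleton_iff.1 hg) f) m)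
    (hg : Integrable (descConj γ (Subgroup.centralizer ({γ} : Set ((cmDatum L N H).Local v)))
      (fun _ hg => Subgroup.mem_centralizer_singleton_iff.1 hg) g) m) :
    localOrbitalIntegral L N H v γ (f + g) m =
      localOrbitalIntegral L N H v γ f m + localOrbitalIntegral L N H v γ g m :=
  orbitalIntegral_add γ m hf hg

/-- `Φ(γ, c • f) = c • Φ(γ, f)`. [cite: Rogawski1990, §4.9 p. 54] -/
theorem localOrbitalIntegral_smul (c : ℂ) (f : (cmDatum L N H).Local v → ℂ) :
    localOrbitalIntegral L N H v γ (c • f) m = c • localOrbitalIntegral L N H v γ f m :=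
  orbitalIntegral_smul γ m c f

/-- `Φ(γ, f) = 0` if no conjugate of `γ` meets `tsupport f`. [cite: Rogawski1990, §4.9 p. 54] -/
theorem localOrbitalIntegral_eq_zero_of_forall_notMem_tsupport {f : (cmDatum L N H).Local v → ℂ}
    (h : ∀ g : (cmDatum L N H).Local v, g * γ * g⁻¹ ∉ tsupport f) :
    localOrbitalIntegral L N H v γ f m = 0 :=
  orbitalIntegral_eq_zero_of_forall_notMem_tsupport γ m h

end UnitaryGroup

end Literature.NumberTheory.Automorphic
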